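import Mathlib
import HarnessLib
import Summits.HubbardSuperconductivity.HubbardSuperconductivity.Theorems.KLProgrammeKLRegimeEngineTowerLipschitzBridgeGeom

/-!
# Route `KLProgramme` — crux K3 ENGINE (stmt-HubbardSuperconductivity-20437 `KLRegimeEngineV17F2`), stub (e) proof-input «(e)-D-ROWS»: THE TWO-VOLUME DIFFERENCE
# TOWER WITH A LINEAR STEP AND A GEOMETRIC BUDGET — ALL DEGREES, NO CLOSING NUMERICS
# (seat hubbard-kl-k3c4-p1 g25, VL lane; DROWS-SCOPE-g25 §13 item 6: replaces `…EngineTowerLipschitzProfileTok.towerBornDiff_le_law_of_profile_tok` (T3-Lip, profile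
#  form) as the vehicle of F-D7)

WHY.  T3-Lip (`towerBornDiff_le_law_of_profile_tok`) closes the two-volume tower in degrees `2p ≥ 6` from IMPORTED degree-`2`/`4` differences (`hdι₁`, `hdι₂`) and
T3's tight closing numerics (`hclose`, `hy`, `hθ`).  For the (e)-D-ROWS the degree-`2`/`4` differences are the OUTPUT (the dual rows read the two-leg kernel), so
they cannot be imported (DROWS-SCOPE-g25 §13: ledger row N11 of DROWS-SCOPE-g24 §12.4 is withdrawn); and the two-volume jump counting of the tree is marginal /
mildly divergent (item 3).  Both are resolved by ONE bookkeeping device: a GEOMETRIC relative budget `R k = R₁·Θ^{k−1}`.  The two-volume arrays are LINEAR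
perturbations riding on the closed one-volume towers: the step is linear in the difference array (`towerFO`, `towerSLip` are linear in `ν`; the tail is `ν`-free and
vanishes as `N → ∞`, `towerLipStep_le_of_chernoff`), the re-measurement row is linear in the earlier born differences.  So if the step maps the profile `R k·Y` to
`R k·C + (sources ≤ R k·S)` and the row maps the law `R k″·X_b` (`k″ ≤ k`) to `R k·Y` (a geometric series in `χ_m/Θ < 1`, any per-degree growth `χ_m` of the jump
counting — relevant directions included), the induction closes as soon as `C + S ≤ Θ·X_b`: EVERY k-uniform step constant is admissible, the price being the factor
`Θ^{K_b} ≤ Θ^{j/d}` in the final budget, which the registered allowance `d ≤ Q.CL β 0/4 = 2⁵⁸·Psq²·Rsq²·(β²+1)` of `TwoLegDualRowsPkgR16` absorbs (`4^j ≤ 4β`; with the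
tree's Schur-type jump rows `Θ = 2·16^d` at worst, `Θ^{j/d} ≤ 2^{j/d}·16^j`; with row/column-split or momentum-conserving jump doors `8^d`, `4^d`).

* `geomRow_le` — the core estimate `Σ_{k′≤k} a·χ^{k+1−k′}·b k′ ≤ R·(aχX/(1−χ/Θ))` when `b k′ ≤ Θ^{−(k−k′)}·R·X`, `0 ≤ χ < Θ`;
* `towerDiff_le_of_geomBudget_base` (§2, g25 append) — the same RE-BASED AT BLOCK 1: no block-`0` born term; the base datum is `dμ 1 ≤ R₁·Y`
  (the measured two-volume difference of the UV block's output), and the row of block `k ≥ 2` carries the transferred base `a₁χ^{k−1}·dμ 1`;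
* **`towerDiff_le_of_geomBudget`** — arrays `db k p` (born difference of T3-block `k ≥ 2` = model block `k−1`; `0` below block `2`), `dμ k m` (measured difference of
  block `k ≥ 1`), all degree indices `1 ≤ m, p ≤ D`; hypotheses: the ROW `dμ k m ≤ Σ_{k′≤k} a_m χ_m^{k+1−k′} db k′ m + sμ k m` with `sμ k m ≤ R k·ΔX m`, the profile
  envelope `a_mχ_mX_b m/(1−χ_m/Θ) + ΔX m ≤ Y m`, the LINEAR STEP `(∀ m, dμ k m ≤ R k·Y m) → db (k+1) p ≤ R k·C p + src k p` with `src k p ≤ R k·S p`, and the closing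
  `C p + S p ≤ Θ·X_b p`; conclusion: `db k p ≤ R k·X_b p` (`2 ≤ k ≤ K`) and `dμ k m ≤ R k·Y m` (`1 ≤ k < K`), `R k = R₁Θ^{k−1}`.

Pure real analysis; nothing about the model is asserted; nothing asserts the (D) rows, stub (e), VL, K3 or superconductivity.
References: BGM 2006 §2.8 (2.93)–(2.98), §3 [cite: BenfattoGiulianiMastropietro2006]; Gawȩdzki–Kupiainen 1985 §3.
-/

noncomputable section

namespace Summit.HubbardSuperconductivity.HubbardSuperconductivity.Theorems.EngineV8

set_option linter.dupNamespace false -- summit = problem name (single-conjunct summit), D-0017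

open Real Finset

/-- **Core estimate of the geometric budget**: if `b k′ ≤ Θ^{−(k−k′)}·R·X` for `k′ ≤ k` (the law against a budget growing by `Θ ≥ 1` per block), `0 ≤ R`, `0 ≤ X`,
`0 ≤ a`, `0 ≤ χ < Θ`, then `Σ_{k′≤k} a·χ^{k+1−k′}·b k′ ≤ R·(a·χ·X/(1 − χ/Θ))`. -/
theorem geomRow_le {b : ℕ → ℝ} {R X a χ Θ : ℝ} {k : ℕ} (hR : 0 ≤ R) (hX : 0 ≤ X) (ha : 0 ≤ a) (hχ : 0 ≤ χ) (hΘ : 1 ≤ Θ) (hχΘ : χ < Θ)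
    (hborn : ∀ k' ≤ k, b k' ≤ (Θ⁻¹) ^ (k - k') * R * X) :
    ∑ k' ∈ range (k + 1), a * χ ^ (k + 1 - k') * b k' ≤ R * (a * χ * X / (1 - χ / Θ)) := by
  have hΘ0 : 0 < Θ := one_pos.trans_le hΘ
  set x : ℝ := χ / Θ with hxdef
  have hx0 : 0 ≤ x := by positivity
  have hx1 : x < 1 := (div_lt_one hΘ0).2 hχΘ
  have hx1' : 0 < 1 - x := sub_pos.2 hx1
  have hterm : ∀ k' ∈ range (k + 1), a * χ ^ (k + 1 - k') * b k' ≤ (a * χ * (R * X)) * x ^ (k - k') := by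
    intro k' hk'
    have hk'le : k' ≤ k := Nat.lt_succ_iff.1 (mem_range.1 hk')
    have hsplit : χ ^ (k + 1 - k') = χ * χ ^ (k - k') := by rw [show k + 1 - k' = (k - k') + 1 by omega, pow_succ]; ring
    have hpow : χ ^ (k - k') * (Θ⁻¹) ^ (k - k') = x ^ (k - k') := by rw [← mul_pow, hxdef, div_eq_mul_inv]
    calc a * χ ^ (k + 1 - k') * b k' ≤ a * χ ^ (k + 1 - k') * ((Θ⁻¹) ^ (k - k') * R * X) :=
          mul_le_mul_of_nonneg_left (hborn k' hk'le) (by positivity)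
      _ = (a * χ * (R * X)) * (χ ^ (k - k') * (Θ⁻¹) ^ (k - k')) := by rw [hsplit]; ring
      _ = (a * χ * (R * X)) * x ^ (k - k') := by rw [hpow]
  refine (sum_le_sum hterm).trans ?_
  rw [← mul_sum]
  have hgeom : ∑ k' ∈ range (k + 1), x ^ (k - k') ≤ 1 / (1 - x) := by
    have hrefl := sum_range_reflect (fun t => x ^ t) (k + 1)
    have : ∑ k' ∈ range (k + 1), x ^ (k - k') = ∑ t ∈ range (k + 1), x ^ t := by
      rw [← hrefl]
      refine sum_congr rfl fun j hj => ?_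
      simp only [Nat.add_sub_cancel]
    rw [this]
    have h := geom_sum_Ico_le_of_lt_one hx0 hx1 (m := 0) (n := k + 1)
    rwa [pow_zero, ← range_eq_Ico] at h
  calc (a * χ * (R * X)) * ∑ k' ∈ range (k + 1), x ^ (k - k') ≤ (a * χ * (R * X)) * (1 / (1 - x)) :=
        mul_le_mul_of_nonneg_left hgeom (by positivity)
    _ = R * (a * χ * X / (1 - x)) := by field_simp

/-- **THE TWO-VOLUME DIFFERENCE TOWER WITH A LINEAR STEP AND A GEOMETRIC BUDGET** (all degree indices `1 ≤ m, p ≤ D`; budget `R k = R₁·Θ^{k−1}`, `Θ ≥ 1`, `R₁ ≥ 0`).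
Arrays: born differences `db k p` (zero below block `2`), measured differences `dμ k m`, row sources `sμ`, step sources `src`; per-degree constants: law `X_b ≥ 0`,
measured profile `Y`, step image `C`, step source `S`, row source `ΔX`, jump growth `χ ≥ 0` with `χ < Θ`, row amplitude `a ≥ 0`.  Hypotheses: the RE-MEASUREMENT ROW
with sources at every block `1 ≤ k < K`; the profile envelope `a χ X_b/(1−χ/Θ) + ΔX ≤ Y`; the LINEAR STEP (from the profile `R k·Y` of `dμ k` to `R k·C + src k`);
the step sources `src k ≤ R k·S`; the closing `C + S ≤ Θ·X_b`.  Conclusion: `db k p ≤ R k·X_b p` for `2 ≤ k ≤ K` and `dμ k m ≤ R k·Y m` for `1 ≤ k < K`.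
[cite: BenfattoGiulianiMastropietro2006, §2.8 (2.93)-(2.98), §3] -/
theorem towerDiff_le_of_geomBudget {D K : ℕ} {db dμ sμ src : ℕ → ℕ → ℝ} {Xb Y C S ΔX a χ : ℕ → ℝ} {R₁ Θ : ℝ}
    (hΘ : 1 ≤ Θ) (hR₁ : 0 ≤ R₁)
    (hXb0 : ∀ m, 0 ≤ Xb m) (ha : ∀ m, 0 ≤ a m) (hχ : ∀ m, 0 ≤ χ m) (hχΘ : ∀ m, 1 ≤ m → m ≤ D → χ m < Θ)
    (hdblow : ∀ k', k' < 2 → ∀ m, db k' m = 0)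
    (hrow : ∀ k, 1 ≤ k → k < K → ∀ m, 1 ≤ m → m ≤ D →
      dμ k m ≤ (∑ k' ∈ range (k + 1), a m * χ m ^ (k + 1 - k') * db k' m) + sμ k m)
    (hsμ : ∀ k, 1 ≤ k → k < K → ∀ m, 1 ≤ m → m ≤ D → sμ k m ≤ R₁ * Θ ^ (k - 1) * ΔX m)
    (hY : ∀ m, 1 ≤ m → m ≤ D → a m * χ m * Xb m / (1 - χ m / Θ) + ΔX m ≤ Y m)
    (hstep : ∀ k, 1 ≤ k → k < K → (∀ m, 1 ≤ m → m ≤ D → dμ k m ≤ R₁ * Θ ^ (k - 1) * Y m) →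
      ∀ p, 1 ≤ p → p ≤ D → db (k + 1) p ≤ R₁ * Θ ^ (k - 1) * C p + src k p)
    (hsrc : ∀ k, 1 ≤ k → k < K → ∀ p, 1 ≤ p → p ≤ D → src k p ≤ R₁ * Θ ^ (k - 1) * S p)
    (hC : ∀ p, 1 ≤ p → p ≤ D → C p + S p ≤ Θ * Xb p) :
    (∀ k, 2 ≤ k → k ≤ K → ∀ p, 1 ≤ p → p ≤ D → db k p ≤ R₁ * Θ ^ (k - 1) * Xb p) ∧
      (∀ k, 1 ≤ k → k < K → ∀ m, 1 ≤ m → m ≤ D → dμ k m ≤ R₁ * Θ ^ (k - 1) * Y m) := by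
  have hΘ0 : 0 < Θ := one_pos.trans_le hΘ
  -- the measured profile of block `k` from the law on the born differences of the blocks `≤ k`
  have hprof : ∀ k, 1 ≤ k → k < K → (∀ k', 2 ≤ k' → k' ≤ k → ∀ p, 1 ≤ p → p ≤ D → db k' p ≤ R₁ * Θ ^ (k' - 1) * Xb p) →
      ∀ m, 1 ≤ m → m ≤ D → dμ k m ≤ R₁ * Θ ^ (k - 1) * Y m := by
    intro k hk1 hkK ih m hm hmD
    have hRk : 0 ≤ R₁ * Θ ^ (k - 1) := by positivity
    have hborn : ∀ k' ≤ k, db k' m ≤ (Θ⁻¹) ^ (k - k') * (R₁ * Θ ^ (k - 1)) * Xb m := by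
      intro k' hk'
      rcases Nat.lt_or_ge k' 2 with hlt | hge
      · rw [hdblow k' hlt m]; have := hXb0 m; positivity
      · refine (ih k' hge hk' m hm hmD).trans (le_of_eq ?_)
        have hsplit : Θ ^ (k - 1) = Θ ^ (k - k') * Θ ^ (k' - 1) := by rw [← pow_add]; congr 1; omega
        rw [hsplit, inv_pow]
        field_simp
    have hgeo := geomRow_le (b := fun k' => db k' m) hRk (hXb0 m) (ha m) (hχ m) hΘ (hχΘ m hm hmD) hborn
    calc dμ k m ≤ (∑ k' ∈ range (k + 1), a m * χ m ^ (k + 1 - k') * db k' m) + sμ k m := hrow k hk1 hkK m hm hmD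
      _ ≤ R₁ * Θ ^ (k - 1) * (a m * χ m * Xb m / (1 - χ m / Θ)) + R₁ * Θ ^ (k - 1) * ΔX m := add_le_add hgeo (hsμ k hk1 hkK m hm hmD)
      _ = R₁ * Θ ^ (k - 1) * (a m * χ m * Xb m / (1 - χ m / Θ) + ΔX m) := by ring
      _ ≤ R₁ * Θ ^ (k - 1) * Y m := mul_le_mul_of_nonneg_left (hY m hm hmD) hRk
  -- strong induction on the block
  suffices H : ∀ k, 1 ≤ k → k ≤ K → ∀ k', 2 ≤ k' → k' ≤ k → ∀ p, 1 ≤ p → p ≤ D → db k' p ≤ R₁ * Θ ^ (k' - 1) * Xb p from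
    ⟨fun k hk2 hkK p hp hpD => H k (by omega) hkK k hk2 le_rfl p hp hpD,
      fun k hk1 hkK m hm hmD => hprof k hk1 hkK (fun k' hk'2 hk'le p hp hpD => H k hk1 hkK.le k' hk'2 hk'le p hp hpD) m hm hmD⟩
  intro k
  induction k with
  | zero => intro h; exact absurd h (by omega)
  | succ k ih =>
    intro _ hkK k' hk'2 hk'le p hp hpD
    rcases Nat.lt_or_ge k' (k + 1) with hlt | hge
    · exact ih (by omega) (by omega) k' hk'2 (by omega) p hp hpD
    · obtain rfl : k' = k + 1 := le_antisymm hk'le hge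
      have hk1 : 1 ≤ k := by omega
      have hkK' : k < K := by omega
      have ihB : ∀ k'', 2 ≤ k'' → k'' ≤ k → ∀ p, 1 ≤ p → p ≤ D → db k'' p ≤ R₁ * Θ ^ (k'' - 1) * Xb p :=
        fun k'' h2 hle p hp hpD => ih hk1 hkK'.le k'' h2 hle p hp hpD
      have hμk := hprof k hk1 hkK' ihB
      have hRk : 0 ≤ R₁ * Θ ^ (k - 1) := by positivity
      calc db (k + 1) p ≤ R₁ * Θ ^ (k - 1) * C p + src k p := hstep k hk1 hkK' hμk p hp hpD
        _ ≤ R₁ * Θ ^ (k - 1) * C p + R₁ * Θ ^ (k - 1) * S p := add_le_add le_rfl (hsrc k hk1 hkK' p hp hpD)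
        _ = R₁ * Θ ^ (k - 1) * (C p + S p) := by ring
        _ ≤ R₁ * Θ ^ (k - 1) * (Θ * Xb p) := mul_le_mul_of_nonneg_left (hC p hp hpD) hRk
        _ = R₁ * Θ ^ (k + 1 - 1) * Xb p := by
            rw [show k + 1 - 1 = (k - 1) + 1 by omega, pow_succ]; ring

/-! ## §2 Re-based at block 1: the base datum is the measured difference of block 1 (the UV block's output), no block-0 born term -/

/-- **THE DIFFERENCE TOWER WITH A LINEAR STEP AND A GEOMETRIC BUDGET, RE-BASED AT BLOCK 1.**  As `towerDiff_le_of_geomBudget`, but the re-measurement row of block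
`k ≥ 2` reads the earlier born differences `db k″` (`2 ≤ k″ ≤ k`) AND the transferred base `a₁_m·χ_m^{k−1}·dμ 1 m` (the measured difference of block `1` jumped to
block `k`), and block `1` is the BASE: `dμ 1 m ≤ R₁·Y m` is a hypothesis (the two-volume UV datum).  Envelope: `a_mχ_mX_b m/(1−χ_m/Θ) + a₁_m(χ_m/Θ)·Y m + ΔX m ≤ Y m`.
[cite: BenfattoGiulianiMastropietro2006, §2.8 (2.93)-(2.98), §3] -/
theorem towerDiff_le_of_geomBudget_base {D K : ℕ} {db dμ sμ src : ℕ → ℕ → ℝ} {Xb Y C S ΔX a χ a₁ : ℕ → ℝ} {R₁ Θ : ℝ}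
    (hΘ : 1 ≤ Θ) (hR₁ : 0 ≤ R₁)
    (hXb0 : ∀ m, 0 ≤ Xb m) (hY0 : ∀ m, 1 ≤ m → m ≤ D → 0 ≤ Y m) (ha : ∀ m, 0 ≤ a m) (ha₁ : ∀ m, 0 ≤ a₁ m) (hχ : ∀ m, 0 ≤ χ m)
    (hχΘ : ∀ m, 1 ≤ m → m ≤ D → χ m < Θ)
    (hdblow : ∀ k', k' < 2 → ∀ m, db k' m = 0)
    (hbase : ∀ m, 1 ≤ m → m ≤ D → dμ 1 m ≤ R₁ * Y m)
    (hrow : ∀ k, 2 ≤ k → k < K → ∀ m, 1 ≤ m → m ≤ D →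
      dμ k m ≤ (∑ k' ∈ range (k + 1), a m * χ m ^ (k + 1 - k') * db k' m) + a₁ m * χ m ^ (k - 1) * dμ 1 m + sμ k m)
    (hsμ : ∀ k, 2 ≤ k → k < K → ∀ m, 1 ≤ m → m ≤ D → sμ k m ≤ R₁ * Θ ^ (k - 1) * ΔX m)
    (hY : ∀ m, 1 ≤ m → m ≤ D → a m * χ m * Xb m / (1 - χ m / Θ) + a₁ m * (χ m / Θ) * Y m + ΔX m ≤ Y m)
    (hstep : ∀ k, 1 ≤ k → k < K → (∀ m, 1 ≤ m → m ≤ D → dμ k m ≤ R₁ * Θ ^ (k - 1) * Y m) →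
      ∀ p, 1 ≤ p → p ≤ D → db (k + 1) p ≤ R₁ * Θ ^ (k - 1) * C p + src k p)
    (hsrc : ∀ k, 1 ≤ k → k < K → ∀ p, 1 ≤ p → p ≤ D → src k p ≤ R₁ * Θ ^ (k - 1) * S p)
    (hC : ∀ p, 1 ≤ p → p ≤ D → C p + S p ≤ Θ * Xb p) :
    (∀ k, 2 ≤ k → k ≤ K → ∀ p, 1 ≤ p → p ≤ D → db k p ≤ R₁ * Θ ^ (k - 1) * Xb p) ∧
      (∀ k, 1 ≤ k → k < K → ∀ m, 1 ≤ m → m ≤ D → dμ k m ≤ R₁ * Θ ^ (k - 1) * Y m) := by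
  have hΘ0 : 0 < Θ := one_pos.trans_le hΘ
  -- the measured profile of block `k` from the law on the born differences of the blocks `≤ k` and the base
  have hprof : ∀ k, 1 ≤ k → k < K → (∀ k', 2 ≤ k' → k' ≤ k → ∀ p, 1 ≤ p → p ≤ D → db k' p ≤ R₁ * Θ ^ (k' - 1) * Xb p) →
      ∀ m, 1 ≤ m → m ≤ D → dμ k m ≤ R₁ * Θ ^ (k - 1) * Y m := by
    intro k hk1 hkK ih m hm hmD
    rcases Nat.lt_or_ge k 2 with hk2 | hk2
    · obtain rfl : k = 1 := by omega
      simpa using hbase m hm hmD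
    have hRk : 0 ≤ R₁ * Θ ^ (k - 1) := by positivity
    have hborn : ∀ k' ≤ k, db k' m ≤ (Θ⁻¹) ^ (k - k') * (R₁ * Θ ^ (k - 1)) * Xb m := by
      intro k' hk'
      rcases Nat.lt_or_ge k' 2 with hlt | hge
      · rw [hdblow k' hlt m]; have := hXb0 m; positivity
      · refine (ih k' hge hk' m hm hmD).trans (le_of_eq ?_)
        have hsplit : Θ ^ (k - 1) = Θ ^ (k - k') * Θ ^ (k' - 1) := by rw [← pow_add]; congr 1; omega
        rw [hsplit, inv_pow]
        field_simp
    have hgeo := geomRow_le (b := fun k' => db k' m) hRk (hXb0 m) (ha m) (hχ m) hΘ (hχΘ m hm hmD) hborn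
    -- the transferred base: `a₁ χ^{k−1} dμ 1 ≤ R₁Θ^{k−1}·a₁ (χ/Θ) Y` for `k ≥ 2`
    have hq0 : 0 ≤ χ m / Θ := by have := hχ m; positivity
    have hq1 : χ m / Θ ≤ 1 := (div_le_one hΘ0).2 (hχΘ m hm hmD).le
    have hbaseT : a₁ m * χ m ^ (k - 1) * dμ 1 m ≤ R₁ * Θ ^ (k - 1) * (a₁ m * (χ m / Θ) * Y m) := by
      have h1 : a₁ m * χ m ^ (k - 1) * dμ 1 m ≤ a₁ m * χ m ^ (k - 1) * (R₁ * Y m) :=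
        mul_le_mul_of_nonneg_left (hbase m hm hmD) (by have := ha₁ m; have := hχ m; positivity)
      have h2 : (χ m / Θ) ^ (k - 1) ≤ χ m / Θ := by
        obtain ⟨j, hj⟩ : ∃ j, k - 1 = j + 1 := ⟨k - 2, by omega⟩
        rw [hj, pow_succ]
        exact (mul_le_of_le_one_left hq0 (pow_le_one₀ hq0 hq1)).trans le_rfl
      have h3 : χ m ^ (k - 1) = Θ ^ (k - 1) * (χ m / Θ) ^ (k - 1) := by
        rw [← mul_pow, mul_div_cancel₀ _ hΘ0.ne']
      have hY := hY0 m hm hmD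
      calc a₁ m * χ m ^ (k - 1) * dμ 1 m ≤ a₁ m * χ m ^ (k - 1) * (R₁ * Y m) := h1
        _ = R₁ * Θ ^ (k - 1) * (a₁ m * (χ m / Θ) ^ (k - 1) * Y m) := by rw [h3]; ring
        _ ≤ R₁ * Θ ^ (k - 1) * (a₁ m * (χ m / Θ) * Y m) := by
            have := ha₁ m
            gcongr
    calc dμ k m ≤ (∑ k' ∈ range (k + 1), a m * χ m ^ (k + 1 - k') * db k' m) + a₁ m * χ m ^ (k - 1) * dμ 1 m + sμ k m :=
          hrow k hk2 hkK m hm hmD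
      _ ≤ R₁ * Θ ^ (k - 1) * (a m * χ m * Xb m / (1 - χ m / Θ)) + R₁ * Θ ^ (k - 1) * (a₁ m * (χ m / Θ) * Y m) +
            R₁ * Θ ^ (k - 1) * ΔX m := add_le_add (add_le_add hgeo hbaseT) (hsμ k hk2 hkK m hm hmD)
      _ = R₁ * Θ ^ (k - 1) * (a m * χ m * Xb m / (1 - χ m / Θ) + a₁ m * (χ m / Θ) * Y m + ΔX m) := by ring
      _ ≤ R₁ * Θ ^ (k - 1) * Y m := mul_le_mul_of_nonneg_left (hY m hm hmD) hRk
  -- strong induction on the block (verbatim from `towerDiff_le_of_geomBudget`)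
  suffices H : ∀ k, 1 ≤ k → k ≤ K → ∀ k', 2 ≤ k' → k' ≤ k → ∀ p, 1 ≤ p → p ≤ D → db k' p ≤ R₁ * Θ ^ (k' - 1) * Xb p from
    ⟨fun k hk2 hkK p hp hpD => H k (by omega) hkK k hk2 le_rfl p hp hpD,
      fun k hk1 hkK m hm hmD => hprof k hk1 hkK (fun k' hk'2 hk'le p hp hpD => H k hk1 hkK.le k' hk'2 hk'le p hp hpD) m hm hmD⟩
  intro k
  induction k with
  | zero => intro h; exact absurd h (by omega)
  | succ k ih =>
    intro _ hkK k' hk'2 hk'le p hp hpD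
    rcases Nat.lt_or_ge k' (k + 1) with hlt | hge
    · exact ih (by omega) (by omega) k' hk'2 (by omega) p hp hpD
    · obtain rfl : k' = k + 1 := le_antisymm hk'le hge
      have hk1 : 1 ≤ k := by omega
      have hkK' : k < K := by omega
      have ihB : ∀ k'', 2 ≤ k'' → k'' ≤ k → ∀ p, 1 ≤ p → p ≤ D → db k'' p ≤ R₁ * Θ ^ (k'' - 1) * Xb p :=
        fun k'' h2 hle p hp hpD => ih hk1 hkK'.le k'' h2 hle p hp hpD
      have hμk := hprof k hk1 hkK' ihB
      have hRk : 0 ≤ R₁ * Θ ^ (k - 1) := by positivity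
      calc db (k + 1) p ≤ R₁ * Θ ^ (k - 1) * C p + src k p := hstep k hk1 hkK' hμk p hp hpD
        _ ≤ R₁ * Θ ^ (k - 1) * C p + R₁ * Θ ^ (k - 1) * S p := add_le_add le_rfl (hsrc k hk1 hkK' p hp hpD)
        _ = R₁ * Θ ^ (k - 1) * (C p + S p) := by ring
        _ ≤ R₁ * Θ ^ (k - 1) * (Θ * Xb p) := mul_le_mul_of_nonneg_left (hC p hp hpD) hRk
        _ = R₁ * Θ ^ (k + 1 - 1) * Xb p := by
            rw [show k + 1 - 1 = (k - 1) + 1 by omega, pow_succ]; ring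

end Summit.HubbardSuperconductivity.HubbardSuperconductivity.Theorems.EngineV8

end
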